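import Mathlib
import HarnessLib
import Summits.NavierStokesRegularity.NavierStokesRegularity.Theorems.AxisTwistDoorAveragedConeLiouvilleCylFrame

/-!
# Route `HalfSpaceWindowDoor`, crux `CirculationCarryingRigidity` (stmt-NavierStokesRegularity-25311) —
# line `angular_flux` (LEAD ns-hsw-p1 g13): under the closed-hemisphere sign the EDDY vertical vorticity on every axis circle
# is `L¹`-dominated by the mean: `∮ |ω₃ − ω̄₃| dl ≤ 2 ∮ ω₃ dl = 2 ∂ᵣΓ`

The sign `ω₃ ≥ 0` has exactly one pointwise consequence on a circle `S(r,z)`: the fluctuation `ω₃ − ω̄₃` of the vertical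
vorticity about its circle mean `ω̄₃ = (2πr)⁻¹∮ω₃ dl` has `L¹`-norm at most twice the mean flux density `∮ω₃ dl = ∂ᵣΓ`
(`…CircleStokes.deriv_circ_eq_vortCirc`).  Beyond the flux tube (`∂ᵣΓ` small) the non-axisymmetric part of the flow is
therefore `ω₃`-FREE to first order — the far-field eddies that must carry the inward angular-momentum flux `S_eddy ≍ −c/r`
(card `Lines/angular_flux.md` §3) are curl_h-free «petal» modes.  Elementary (`|f − m| ≤ f + m` for `f, m ≥ 0`); stated for an
arbitrary nonnegative integrand on `[0, 2π]` (`integral_abs_sub_mean_le`) and in the crux vocabulary (`eddyVort_abs_le`).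

Seat ns-hsw-p1 g13, `--supports stmt-NavierStokesRegularity-25311 --as helper`.  WHAT THIS IS NOT: not about NS regularity;
circle bookkeeping for HYPOTHETICAL profiles; nothing is closed by this file.
-/

noncomputable section

-- the summit and its single sub-problem share the name (CONVENTIONS §1), as in every Theorems file
set_option linter.dupNamespace false

namespace Summit.NavierStokesRegularity.NavierStokesRegularity.Theorems.HalfSpaceWindowDoorCirculationCarryingRigidityEddySign

open Set MeasureTheory intervalIntegral
open scoped InnerProductSpace RealInnerProductSpace
open Literature.Analysis.FluidPDE hiding eR
open Summit.NavierStokesRegularity.NavierStokesRegularity.Theorems.AxisTwistDoorAveragedConeLiouvilleDefs (cylPt e3 vortCirc)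
open Summit.NavierStokesRegularity.NavierStokesRegularity.Theorems.AxisTwistDoorAveragedConeLiouvilleCylFrame (continuous_cylPt_θ)

/-- For a nonnegative integrable `f` on `[0, 2π]` with mean `m = (2π)⁻¹∫f`: `∫₀^{2π} |f − m| ≤ 2 ∫₀^{2π} f`. -/
theorem integral_abs_sub_mean_le {f : ℝ → ℝ} (hf : IntervalIntegrable f volume 0 (2 * Real.pi))
    (h0 : ∀ θ ∈ Icc (0 : ℝ) (2 * Real.pi), 0 ≤ f θ) :
    ∫ θ in (0 : ℝ)..(2 * Real.pi), |f θ - (2 * Real.pi)⁻¹ * ∫ φ in (0 : ℝ)..(2 * Real.pi), f φ|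
      ≤ 2 * ∫ θ in (0 : ℝ)..(2 * Real.pi), f θ := by
  have h2π : (0 : ℝ) ≤ 2 * Real.pi := by positivity
  set I := ∫ φ in (0 : ℝ)..(2 * Real.pi), f φ with hI
  have hI0 : 0 ≤ I := intervalIntegral.integral_nonneg h2π h0
  have hm0 : 0 ≤ (2 * Real.pi)⁻¹ * I := by positivity
  calc ∫ θ in (0 : ℝ)..(2 * Real.pi), |f θ - (2 * Real.pi)⁻¹ * I|
      ≤ ∫ θ in (0 : ℝ)..(2 * Real.pi), (f θ + (2 * Real.pi)⁻¹ * I) := by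
        refine intervalIntegral.integral_mono_on h2π ?_ (hf.add intervalIntegrable_const) fun θ hθ => ?_
        · exact (hf.sub intervalIntegrable_const).abs
        · have := h0 θ hθ
          rw [abs_le]; constructor <;> linarith
    _ = I + 2 * Real.pi * ((2 * Real.pi)⁻¹ * I) := by
        rw [intervalIntegral.integral_add hf intervalIntegrable_const, intervalIntegral.integral_const, smul_eq_mul]
        ring
    _ = 2 * I := by field_simp; ring

/-- **Eddy vertical vorticity is `L¹`-slaved to the mean under the sign.**  For a continuous slice with `⟪curl v(s), e₃⟫ ≥ 0` on
the circle `S(r,z)`, `r ≥ 0`: `∫₀^{2π} |ω₃ r − (2π)⁻¹ ∮ω₃ dl| dθ ≤ 2 ∮ω₃ dl` (`∮ω₃ dl = vortCirc v r z s = ∂ᵣΓ`). -/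
theorem eddyVort_abs_le {v : ℝ → EuclideanSpace ℝ (Fin 3) → EuclideanSpace ℝ (Fin 3)} {s : ℝ}
    (hv : ContDiff ℝ 1 (v s)) {r : ℝ} (hr : 0 ≤ r) (z : ℝ)
    (hsign : ∀ θ : ℝ, 0 ≤ ⟪curl (v s) (cylPt r θ z), e3⟫_ℝ) :
    ∫ θ in (0 : ℝ)..(2 * Real.pi), |⟪curl (v s) (cylPt r θ z), e3⟫_ℝ * r - (2 * Real.pi)⁻¹ * vortCirc v r z s|
      ≤ 2 * vortCirc v r z s := by
  unfold vortCirc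
  have hc : Continuous fun θ => ⟪curl (v s) (cylPt r θ z), e3⟫_ℝ * r :=
    (((continuous_curl hv).comp (continuous_cylPt_θ r z)).inner continuous_const).mul continuous_const
  exact integral_abs_sub_mean_le (hc.intervalIntegrable _ _) fun θ _ => mul_nonneg (hsign θ) hr

end Summit.NavierStokesRegularity.NavierStokesRegularity.Theorems.HalfSpaceWindowDoorCirculationCarryingRigidityEddySign

end
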